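import Summits.BirchSwinnertonDyer.BirchSwinnertonDyer.Theses.SemiOrdinaryEisensteinDescent
import Summits.BirchSwinnertonDyer.BirchSwinnertonDyer.Theorems.SemiOrdinaryEisensteinDescentWildKolyvaginUpperAtThreeTowerFree
import HarnessLib

/-!
# Route `SemiOrdinaryEisensteinDescent`: the glue item `WildKolyvaginUpperAtThreeTowerFreeOfSigma`
# (stmt-BirchSwinnertonDyer-24703, gen-1 split of crux Ko′ 24696) CLOSED by soed-p2-w2 g3's receptacle

`WildKolyvaginUpperAtThreeTowerFreeOfSigma := CasselsTateLevelInputsFact → GrossProp372FrobeniusCongruenceInput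
→ GrossHeegnerPointE0Input → WildSigmaDivisibilityAtThreeTowerFree → WildKolyvaginUpperAtThreeTowerFree`:
the three McCallum-road primitives BY NAME (levelwise Cassels–Tate inputs, Gross 1991 Prop. 3.7 (2), Gross 1991
«Heegner point minus rational torsion lies in E⁰») and the tower-free Σ-divisibility crux J′ (24702) give the
tower-free Kolyvagin–McCallum upper bound Ko′ (24696) — by
`WildKolyvaginUpperAtThreeTowerFree.koTowerFree_of_sigmaTowerFree_of_threePrimitives` (p594241), whose four
displayed hypotheses ARE the four children verbatim. Pure glue (prover bsd-wall-utd-p3 g8, pen ticket XS of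
2026-08-28T02:19Z); BSD is not proved by any of this.

References: [McCallumLMS1991] §3, §5 Thm. 5.4/5.8; [GrossLMS1991] Prop. 3.7 (2) (p. 240), §5 (5.1); [Cha2005]
Thm. 3, Thm. 7.
-/

set_option autoImplicit false
set_option linter.dupNamespace false

namespace Summit.BirchSwinnertonDyer.BirchSwinnertonDyer.Theorems

open Summit.BirchSwinnertonDyer.BirchSwinnertonDyer.Theses.SemiOrdinaryEisensteinDescent

/-- **Glue 24703**: CT ∧ Gross 3.7(2) ∧ Gross E⁰ ∧ J′ ⟹ crux Ko′ `WildKolyvaginUpperAtThreeTowerFree`, by the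
receptacle `WildKolyvaginUpperAtThreeTowerFree.koTowerFree_of_sigmaTowerFree_of_threePrimitives` (p594241).
[cite: McCallumLMS1991, §3 and §5 Thm. 5.4] [cite: GrossLMS1991, Prop. 3.7 (2) (p. 240)] -/
theorem wildKolyvaginUpperAtThreeTowerFreeOfSigma_proof : WildKolyvaginUpperAtThreeTowerFreeOfSigma :=
  fun h₁ h₂ h₃ h₄ ↦
    WildKolyvaginUpperAtThreeTowerFree.koTowerFree_of_sigmaTowerFree_of_threePrimitives h₁ h₂ h₃ h₄

end Summit.BirchSwinnertonDyer.BirchSwinnertonDyer.Theorems
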